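import Summits.QuantumFields.GaugeBoot.FiniteNSymmetrizedDefect
import HarnessLib

/-!
# Quantitative gauge–string duality: an explicit `1/N` + boundary rate for Chatterjee's Theorem 3.1 (gauge-boot, ADDENDUM 28 part Q)

HONEST FRAMING (cell `pub-gaugeboot`, page 1 of every file): the venture produces certified bounds
on lattice expectations at stated coupling, gauge group, dimension and torus size; NOT a mass gap,
NOT a continuum limit, NOT a string tension; NOT Yang–Mills-summit-bearing (barriers
`FixedCouplingUltralocality`, `PerturbativeInvisibility`).  This file is about the STRONG-COUPLING regime of `SO(N)`
lattice gauge theory with free boundary condition in `ℤ^d`, `d ≥ 2`, at FINITE `N` and FINITE volume; it says nothing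
about four-dimensional continuum Yang–Mills or a mass gap.

## Content

S. Chatterjee, *Rigorous solution of strongly coupled `SO(N)` lattice gauge theory in the large `N` limit*, Comm. Math.
Phys. **366** (2019), Theorem 3.1 (proved in the sibling `GaugeStringDuality`) is QUALITATIVE: `⟨W_{l₁}⋯W_{lₙ}⟩_{Λ_N,N,β}/Nⁿ →
Σ_{X ∈ 𝒳(s)} w_β(X)`.  Here the same contraction (sibling `SymmetrizedMasterLoopUniqueness`) is run against the FINITE-`N`
symmetrized master loop equation (the source's Theorem 3.6, tree `SOMasterLoop.finiteNMasterLoopEquation_holds`), read as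
the limiting equation plus a defect `N⁻¹ (|s| φ + twistings + N⁻¹ mergers)` of size `≤ 5|s|²/N` (sibling `FiniteNSymmetrizedDefect.finiteN_defect_le`).  Result:

★★★ `abs_phi_sub_trajectorySum_le` — there are `β₀(d) > 0` and `K(d) ≥ 1` such that for EVERY finite non-empty
`Λ ⊂ ℤ^d`, EVERY `N ≥ 2`, every `|β| ≤ β₀`, every `n` and every genuine loop sequence `s` whose splitting/deformation
descendants of generation `< n` all have their unit vertex neighbourhoods inside `Λ` (any depth grading `Good n s`
compatible with the moves),

  `|⟨W_{l₁}⋯W_{lₙ}⟩_{Λ,N,β}/Nⁿ − Σ_{X ∈ 𝒳(s)} w_β(X)| ≤ (3·(3/4)ⁿ + 20/N) · K^{ι(s)} C_{|l₁|−1}⋯C_{|lₙ|−1}`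

(and `K^{ι(s)} Π C ≤ (4K)^{|s|}`, `abs_phi_sub_trajectorySum_le_pow`): the finite-`N` correction to the string
representation is `O(1/N)` uniformly in the volume, and the finite-volume correction decays geometrically in the depth
of `s` inside `Λ`.  Along an exhaustion every depth is eventually available, which re-proves Theorem 3.1 with the rate
(`eventually_abs_phi_sub_trajectorySum_le`).  These quantitative statements are not
in the source.

Everything is `[folklore]` given the source and the two siblings.
-/

noncomputable section

open Finset Filter Topology
open Literature.MathematicalPhysics.QuantumFieldTheory (latticeNorm)
open Literature.MathematicalPhysics.QuantumFieldTheory.Chatterjee2019LargeN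
open Literature.MathematicalPhysics.QuantumFieldTheory.Chatterjee2019LargeN.CoeffCatalanBoundProof

namespace Summit.QuantumFields.GaugeBoot

namespace StringDuality

variable {d : ℕ}

/-! ## The rate theorem -/

/-- `|s| ≤ K^{ι(s)} Π(s)` for `K ≥ 4` (`|s| ≤ 2^{|s|} ≤ 4^{ι(s)}`). [cite: Chatterjee2019LargeN, Lemma 9.7 (ι(s) ≥ |s|/2)] -/
theorem len_le_weight {K : ℝ} (hK : 4 ≤ K) {s : LoopSeq d} (hs : IsLoopSeq s) :
    (s.len : ℝ) ≤ K ^ s.index * catProd s := by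
  have hlen : s.len ≤ 2 * s.index := by
    have := two_mul_size_le_len hs
    unfold LoopSeq.index
    omega
  have h1 : s.len ≤ 4 ^ s.index := by
    calc s.len ≤ 2 ^ s.len := (Nat.lt_two_pow_self).le
      _ ≤ 2 ^ (2 * s.index) := Nat.pow_le_pow_right (by norm_num) hlen
      _ = 4 ^ s.index := by rw [pow_mul]; norm_num
  calc (s.len : ℝ) ≤ (4 : ℝ) ^ s.index := by exact_mod_cast h1
    _ ≤ K ^ s.index := pow_le_pow_left₀ (by norm_num) hK _
    _ ≤ K ^ s.index * catProd s := le_mul_of_one_le_right (pow_nonneg (by linarith) _) (one_le_catProd s)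

/-- **One step of the iteration** (the inductive step of `abs_phi_sub_trajectorySum_le`, isolated): if `φ` satisfies the
symmetrized equation at `s` up to a defect `5|s|²/N`, `T` satisfies it exactly, and on all splitting/deformation results
`|φ − T| ≤ c·Φ`, then `|φ(s) − T(s)| ≤ (cθ + 5/N) Φ(s)` for any `θ ≥ 2/K + |β|·2·2(d−1)·256·K⁴`.
[cite: Chatterjee2019LargeN, Theorem 3.6, Theorem 9.9, Lemma 10.1] -/
theorem iterate_step {K θ c β : ℝ} {N : ℕ} (hK4 : 4 ≤ K) (hc0 : 0 ≤ c) (hN0 : (0 : ℝ) < N)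
    (hθ : 2 / K + |β| * (2 * ((2 * (d - 1) : ℕ) : ℝ) * 256 * K ^ 4) ≤ θ)
    {s : LoopSeq d} (hs : IsLoopSeq s) (hne : s ≠ []) (φ T : LoopSeq d → ℝ)
    (hA : |(s.len : ℝ) * φ s -
        ((∑ o : InvIdx s, φ (s.negSplitAt o)) - (∑ o : SameIdx s, φ (s.posSplitAt o))
          + β * (∑ o : DeformIdx s, φ (s.negDeformAt o)) - β * (∑ o : DeformIdx s, φ (s.posDeformAt o)))|
        ≤ 5 * (s.len : ℝ) ^ 2 / N)
    (hB : (s.len : ℝ) * T s =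
        (∑ o : InvIdx s, T (s.negSplitAt o)) - (∑ o : SameIdx s, T (s.posSplitAt o))
          + β * (∑ o : DeformIdx s, T (s.negDeformAt o)) - β * (∑ o : DeformIdx s, T (s.posDeformAt o)))
    (hI : ∀ o : InvIdx s, |φ (s.negSplitAt o) - T (s.negSplitAt o)| ≤
        c * (K ^ (s.negSplitAt o).index * catProd (s.negSplitAt o)))
    (hS : ∀ o : SameIdx s, |φ (s.posSplitAt o) - T (s.posSplitAt o)| ≤
        c * (K ^ (s.posSplitAt o).index * catProd (s.posSplitAt o)))
    (hDn : ∀ o : DeformIdx s, |φ (s.negDeformAt o) - T (s.negDeformAt o)| ≤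
        c * (K ^ (s.negDeformAt o).index * catProd (s.negDeformAt o)))
    (hDp : ∀ o : DeformIdx s, |φ (s.posDeformAt o) - T (s.posDeformAt o)| ≤
        c * (K ^ (s.posDeformAt o).index * catProd (s.posDeformAt o))) :
    |φ s - T s| ≤ (c * θ + 5 / N) * (K ^ s.index * catProd s) := by
  have hK1 : 1 ≤ K := by linarith
  have hK0 : 0 < K := by linarith
  have hlen : (0 : ℝ) < s.len := by exact_mod_cast LoopSeq.len_pos hs hne
  have hΦ0 : 0 ≤ K ^ s.index * catProd s := mul_nonneg (pow_nonneg hK0.le _) (catProd_nonneg _)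
  -- the four weighted sums of the results
  set S₁ : ℝ := ∑ o : InvIdx s, K ^ (s.negSplitAt o).index * catProd (s.negSplitAt o) with hS₁
  set S₂ : ℝ := ∑ o : SameIdx s, K ^ (s.posSplitAt o).index * catProd (s.posSplitAt o) with hS₂
  set S₃ : ℝ := ∑ o : DeformIdx s, K ^ (s.negDeformAt o).index * catProd (s.negDeformAt o) with hS₃
  set S₄ : ℝ := ∑ o : DeformIdx s, K ^ (s.posDeformAt o).index * catProd (s.posDeformAt o) with hS₄
  have e1 : |∑ o : InvIdx s, (φ (s.negSplitAt o) - T (s.negSplitAt o))| ≤ c * S₁ := by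
    refine (Finset.abs_sum_le_sum_abs _ _).trans ?_
    rw [hS₁, Finset.mul_sum]
    exact Finset.sum_le_sum fun o _ => hI o
  have e2 : |∑ o : SameIdx s, (φ (s.posSplitAt o) - T (s.posSplitAt o))| ≤ c * S₂ := by
    refine (Finset.abs_sum_le_sum_abs _ _).trans ?_
    rw [hS₂, Finset.mul_sum]
    exact Finset.sum_le_sum fun o _ => hS o
  have e3 : |∑ o : DeformIdx s, (φ (s.negDeformAt o) - T (s.negDeformAt o))| ≤ c * S₃ := by
    refine (Finset.abs_sum_le_sum_abs _ _).trans ?_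
    rw [hS₃, Finset.mul_sum]
    exact Finset.sum_le_sum fun o _ => hDn o
  have e4 : |∑ o : DeformIdx s, (φ (s.posDeformAt o) - T (s.posDeformAt o))| ≤ c * S₄ := by
    refine (Finset.abs_sum_le_sum_abs _ _).trans ?_
    rw [hS₄, Finset.mul_sum]
    exact Finset.sum_le_sum fun o _ => hDp o
  set Rφ : ℝ := (∑ o : InvIdx s, φ (s.negSplitAt o)) - (∑ o : SameIdx s, φ (s.posSplitAt o))
      + β * (∑ o : DeformIdx s, φ (s.negDeformAt o)) - β * (∑ o : DeformIdx s, φ (s.posDeformAt o)) with hRφ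
  set RT : ℝ := (∑ o : InvIdx s, T (s.negSplitAt o)) - (∑ o : SameIdx s, T (s.posSplitAt o))
      + β * (∑ o : DeformIdx s, T (s.negDeformAt o)) - β * (∑ o : DeformIdx s, T (s.posDeformAt o)) with hRT
  have hdiff : Rφ - RT =
      ((∑ o : InvIdx s, (φ (s.negSplitAt o) - T (s.negSplitAt o)))
        - ∑ o : SameIdx s, (φ (s.posSplitAt o) - T (s.posSplitAt o)))
        + β * ((∑ o : DeformIdx s, (φ (s.negDeformAt o) - T (s.negDeformAt o)))
          - ∑ o : DeformIdx s, (φ (s.posDeformAt o) - T (s.posDeformAt o))) := by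
    rw [hRφ, hRT]
    simp only [Finset.sum_sub_distrib]
    ring
  have hR : |Rφ - RT| ≤ c * ((S₁ + S₂) + |β| * (S₃ + S₄)) := by
    rw [hdiff]
    calc _ ≤ |(∑ o : InvIdx s, (φ (s.negSplitAt o) - T (s.negSplitAt o)))
            - ∑ o : SameIdx s, (φ (s.posSplitAt o) - T (s.posSplitAt o))|
          + |β * ((∑ o : DeformIdx s, (φ (s.negDeformAt o) - T (s.negDeformAt o)))
            - ∑ o : DeformIdx s, (φ (s.posDeformAt o) - T (s.posDeformAt o)))| := abs_add_le _ _
      _ ≤ (c * S₁ + c * S₂) + |β| * (c * S₃ + c * S₄) := by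
          refine add_le_add ((abs_sub _ _).trans (add_le_add e1 e2)) ?_
          rw [abs_mul]
          exact mul_le_mul_of_nonneg_left ((abs_sub _ _).trans (add_le_add e3 e4)) (abs_nonneg β)
      _ = c * ((S₁ + S₂) + |β| * (S₃ + S₄)) := by ring
  have hop : (S₁ + S₂) + |β| * (S₃ + S₄) ≤ (s.len : ℝ) * (θ * (K ^ s.index * catProd s)) :=
    (operator_weight_le hK1 β hs hne).trans
      (mul_le_mul_of_nonneg_left (mul_le_mul_of_nonneg_right hθ hΦ0) hlen.le)
  -- assemble: `|s| (φ − T) = (|s|φ − Rφ) + (Rφ − RT)`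
  have hkey : (s.len : ℝ) * |φ s - T s| ≤
      (s.len : ℝ) * (5 * (s.len : ℝ) / N + c * θ * (K ^ s.index * catProd s)) := by
    calc (s.len : ℝ) * |φ s - T s| = |((s.len : ℝ) * φ s - Rφ) + (Rφ - RT)| := by
          rw [← abs_of_pos hlen, ← abs_mul, abs_of_pos hlen, mul_sub, hB]
          ring_nf
      _ ≤ |(s.len : ℝ) * φ s - Rφ| + |Rφ - RT| := abs_add_le _ _
      _ ≤ 5 * (s.len : ℝ) ^ 2 / N + c * ((s.len : ℝ) * (θ * (K ^ s.index * catProd s))) :=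
          add_le_add hA (hR.trans (mul_le_mul_of_nonneg_left hop hc0))
      _ = (s.len : ℝ) * (5 * (s.len : ℝ) / N + c * θ * (K ^ s.index * catProd s)) := by ring
  have h1 : |φ s - T s| ≤ 5 * (s.len : ℝ) / N + c * θ * (K ^ s.index * catProd s) :=
    le_of_mul_le_mul_left hkey hlen
  have h2 : 5 * (s.len : ℝ) / N ≤ 5 / N * (K ^ s.index * catProd s) := by
    rw [show 5 * (s.len : ℝ) / N = 5 / N * (s.len : ℝ) by ring]
    exact mul_le_mul_of_nonneg_left (len_le_weight hK4 hs) (by positivity)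
  calc |φ s - T s| ≤ 5 / N * (K ^ s.index * catProd s) + c * θ * (K ^ s.index * catProd s) := by linarith
    _ = (c * θ + 5 / N) * (K ^ s.index * catProd s) := by ring

variable (d)

/-- ★★★ **Quantitative gauge–string duality.**  There are `β₀ = β₀(d) > 0` and `K = K(d) ≥ 1` such that for every
finite non-empty `Λ ⊂ ℤ^d` (`d ≥ 2`), every `N ≥ 2`, every `|β| ≤ β₀`, every depth grading `Good : ℕ → 𝒮 → Prop`
compatible with the moves (depth `n + 1` at `s` gives the unit vertex neighbourhood of `s` inside `Λ` and depth `n` at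
every splitting/deformation result of `s`; e.g. «the `n`-neighbourhood of the vertices of `s` lies in `Λ`»), every `n`
and every genuine loop sequence `s` of depth `n`,
`|φ_{Λ,N,β}(s) − Σ_{X ∈ 𝒳(s)} w_β(X)| ≤ (3 (3/4)ⁿ + 20/N) · K^{ι(s)} C_{|l₁|−1} ⋯ C_{|lₙ|−1}`.
Proof: the Catalan-weighted contraction of `symmetrized_unique` run on `δ = |φ_{Λ,N,β} − T|`, with the exact symmetrized
equation for `T` (`trajectorySum_equation`) and the finite-`N` one for `φ` (`finiteN_defect_le`, defect `5|s|²/N ≤ 5|s|Φ(s)/N`).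
[cite: Chatterjee2019LargeN, Theorem 3.1, Theorem 3.6, Theorem 9.9, Lemma 10.1] -/
theorem abs_phi_sub_trajectorySum_le (hd : 2 ≤ d) :
    ∃ β₀ : ℝ, 0 < β₀ ∧ ∃ K : ℝ, 1 ≤ K ∧
      ∀ Λ : Finset (Literature.Probability.LatticeModels.Site d), Λ.Nonempty → ∀ N : ℕ, 2 ≤ N →
        ∀ β : ℝ, |β| ≤ β₀ → ∀ Good : ℕ → LoopSeq d → Prop,
          (∀ (n : ℕ) (s : LoopSeq d), Good (n + 1) s →
            (∀ l ∈ s, ∀ a ∈ l, ∀ v : Literature.Probability.LatticeModels.Site d,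
                latticeNorm (v - DEdge.src a) ≤ 1 ∨ latticeNorm (v - DEdge.tgt a) ≤ 1 → v ∈ Λ) ∧
              (∀ o : SameIdx s, Good n (s.posSplitAt o)) ∧ (∀ o : InvIdx s, Good n (s.negSplitAt o)) ∧
              (∀ o : DeformIdx s, Good n (s.posDeformAt o)) ∧ (∀ o : DeformIdx s, Good n (s.negDeformAt o))) →
          ∀ (n : ℕ) (s : LoopSeq d), IsLoopSeq s → Good n s →
            |phi N β Λ s - ∑' X : Trajectory s, X.weight β| ≤
              (3 * (3 / 4 : ℝ) ^ n + 20 / N) * (K ^ s.index * catProd s) := by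
  -- constants
  set L : ℝ := 4 * bigK d with hLdef
  have hK1d : 1 ≤ bigK d := one_le_bigK d
  have hL1 : 1 ≤ L := by rw [hLdef]; linarith
  set K : ℝ := L ^ 2 + 4 with hKdef
  have hL2 : 0 ≤ L ^ 2 := sq_nonneg L
  have hK4 : 4 ≤ K := by rw [hKdef]; linarith
  have hK1 : 1 ≤ K := by linarith
  have hK0 : 0 < K := by linarith
  have hLK : L ^ 2 ≤ K := by rw [hKdef]; linarith
  set P : ℝ := ((2 * (d - 1) : ℕ) : ℝ) with hPdef
  have hP0 : 0 ≤ P := Nat.cast_nonneg _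
  have hP : P ≤ 2 * ((d : ℝ) + 1) := by
    have h : (2 * (d - 1) : ℕ) ≤ 2 * (d + 1) := by omega
    rw [hPdef]
    exact_mod_cast h
  have hβ₃ : (0 : ℝ) < 1 / (2 * bigK d ^ 5) := by positivity
  refine ⟨min (1 / (2 * bigK d ^ 5)) (1 / (4096 * ((d : ℝ) + 1) * K ^ 4)), lt_min hβ₃ (by positivity), K, hK1,
    fun Λ hΛ N hN β hβ Good hGood => ?_⟩
  have hb3 : |β| ≤ 1 / (2 * bigK d ^ 5) := hβ.trans (min_le_left _ _)
  have hb4 : |β| ≤ 1 / (4096 * ((d : ℝ) + 1) * K ^ 4) := hβ.trans (min_le_right _ _)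
  have hN0 : (0 : ℝ) < N := by exact_mod_cast (by omega : 0 < N)
  -- the contraction constant
  obtain ⟨θ, hθdef⟩ : ∃ θ : ℝ, θ = 2 / K + |β| * (2 * P * 256 * K ^ 4) := ⟨_, rfl⟩
  have hθ0 : 0 ≤ θ := by rw [hθdef]; positivity
  have hθ1 : θ ≤ 3 / 4 := by
    have h1 : 2 / K ≤ 1 / 2 := by
      rw [div_le_iff₀ hK0]
      linarith
    have h2 : |β| * (2 * P * 256 * K ^ 4) ≤ 1 / 4 := by
      calc |β| * (2 * P * 256 * K ^ 4)
          ≤ (1 / (4096 * ((d : ℝ) + 1) * K ^ 4)) * (2 * (2 * ((d : ℝ) + 1)) * 256 * K ^ 4) := by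
            apply mul_le_mul hb4 _ (by positivity) (by positivity)
            gcongr
        _ = 1 / 4 := by
            field_simp
            ring
    rw [hθdef]
    linarith
  have hθle : 2 / K + |β| * (2 * ((2 * (d - 1) : ℕ) : ℝ) * 256 * K ^ 4) ≤ θ := by rw [hθdef, hPdef]
  -- notation
  set T : LoopSeq d → ℝ := fun t => ∑' X : Trajectory t, X.weight β with hT
  set φ : LoopSeq d → ℝ := fun t => phi N β Λ t with hφ
  -- the iteration
  have hiter : ∀ n : ℕ, ∀ s : LoopSeq d, IsLoopSeq s → Good n s →
      |φ s - T s| ≤ (3 * θ ^ n + 20 / N) * (K ^ s.index * catProd s) := by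
    intro n
    induction n with
    | zero =>
      intro s hs _
      have hΦ1 : L ^ s.len ≤ K ^ s.index * catProd s := pow_len_le_weight hL1 hLK hs
      have hΦ0 : 0 ≤ K ^ s.index * catProd s := mul_nonneg (pow_nonneg hK0.le _) (catProd_nonneg _)
      have h1 : |φ s| ≤ 1 := abs_phi_le_one _ _ _ _
      have h2 : |T s| ≤ 2 * (4 * bigK d) ^ s.len := (trajectorySum_summable_and_abs_le hb3 hs).2
      have h3 : (1 : ℝ) ≤ L ^ s.len := one_le_pow₀ hL1
      calc |φ s - T s| ≤ |φ s| + |T s| := abs_sub _ _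
        _ ≤ 1 + 2 * L ^ s.len := add_le_add h1 h2
        _ ≤ 3 * (K ^ s.index * catProd s) := by linarith
        _ ≤ (3 * θ ^ 0 + 20 / N) * (K ^ s.index * catProd s) := by
            rw [pow_zero, mul_one]
            exact mul_le_mul_of_nonneg_right (by linarith [div_nonneg (by norm_num : (0:ℝ) ≤ 20) hN0.le]) hΦ0
    | succ n ih =>
      intro s hs hdeep
      obtain ⟨hV, hS, hI, hDp, hDn⟩ := hGood n s hdeep
      have hΦ0 : 0 ≤ K ^ s.index * catProd s := mul_nonneg (pow_nonneg hK0.le _) (catProd_nonneg _)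
      by_cases hne : s = []
      · subst hne
        have h0 : φ [] - T [] = 0 := by
          simp only [hφ, hT, phi_nil, trajectorySum_nil, sub_self]
        rw [h0, abs_zero]
        positivity
      have hc0 : 0 ≤ 3 * θ ^ n + 20 / N := by positivity
      have hstep := iterate_step (β := β) hK4 hc0 hN0 hθle hs hne φ T
        (finiteN_defect_le hd hΛ hN β hs hne hV) (trajectorySum_equation hb3 hs hne)
        (fun o => ih _ (hs.negSplitAt o) (hI o)) (fun o => ih _ (hs.posSplitAt o) (hS o))
        (fun o => ih _ (hs.negDeformAt o) (hDn o)) (fun o => ih _ (hs.posDeformAt o) (hDp o))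
      refine hstep.trans (mul_le_mul_of_nonneg_right ?_ hΦ0)
      -- `(3θⁿ + 20/N)θ + 5/N ≤ 3θⁿ⁺¹ + 20/N`
      calc (3 * θ ^ n + 20 / N) * θ + 5 / N = 3 * θ ^ (n + 1) + (20 / N * θ + 5 / N) := by ring
        _ ≤ 3 * θ ^ (n + 1) + (20 / N * (3 / 4) + 5 / N) := by gcongr
        _ = 3 * θ ^ (n + 1) + 20 / N := by ring
  -- `θ ≤ 3/4`
  intro n s hs hdeep
  have hΦ0 : 0 ≤ K ^ s.index * catProd s := mul_nonneg (pow_nonneg hK0.le _) (catProd_nonneg _)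
  refine (hiter n s hs hdeep).trans (mul_le_mul_of_nonneg_right ?_ hΦ0)
  have : θ ^ n ≤ (3 / 4 : ℝ) ^ n := pow_le_pow_left₀ hθ0 hθ1 n
  linarith

/-- ★★★ **Quantitative gauge–string duality, perimeter form**: with `β₀(d) > 0` and `C = C(d) ≥ 1`, for every finite
non-empty `Λ`, `N ≥ 2`, `|β| ≤ β₀`, a depth grading `Good` compatible with the moves, depth `n` and genuine `s` of
depth `n`,
`|⟨W_{l₁}⋯W_{lₙ}⟩_{Λ,N,β}/Nⁿ − Σ_{X ∈ 𝒳(s)} w_β(X)| ≤ C^{|s|} (3 (3/4)ⁿ + 20/N)`.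
[cite: Chatterjee2019LargeN, Theorem 3.1 (qualitative statement)] -/
theorem abs_phi_sub_trajectorySum_le_pow (hd : 2 ≤ d) :
    ∃ β₀ : ℝ, 0 < β₀ ∧ ∃ C : ℝ, 1 ≤ C ∧
      ∀ Λ : Finset (Literature.Probability.LatticeModels.Site d), Λ.Nonempty → ∀ N : ℕ, 2 ≤ N →
        ∀ β : ℝ, |β| ≤ β₀ → ∀ Good : ℕ → LoopSeq d → Prop,
          (∀ (n : ℕ) (s : LoopSeq d), Good (n + 1) s →
            (∀ l ∈ s, ∀ a ∈ l, ∀ v : Literature.Probability.LatticeModels.Site d,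
                latticeNorm (v - DEdge.src a) ≤ 1 ∨ latticeNorm (v - DEdge.tgt a) ≤ 1 → v ∈ Λ) ∧
              (∀ o : SameIdx s, Good n (s.posSplitAt o)) ∧ (∀ o : InvIdx s, Good n (s.negSplitAt o)) ∧
              (∀ o : DeformIdx s, Good n (s.posDeformAt o)) ∧ (∀ o : DeformIdx s, Good n (s.negDeformAt o))) →
          ∀ (n : ℕ) (s : LoopSeq d), IsLoopSeq s → Good n s →
            |phi N β Λ s - ∑' X : Trajectory s, X.weight β| ≤ C ^ s.len * (3 * (3 / 4 : ℝ) ^ n + 20 / N) := by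
  obtain ⟨β₀, hβ₀, K, hK1, H⟩ := abs_phi_sub_trajectorySum_le d hd
  refine ⟨β₀, hβ₀, 4 * K, by linarith, fun Λ hΛ N hN β hβ Good hGood n s hs hdeep => ?_⟩
  have hN0 : (0 : ℝ) < N := by exact_mod_cast (by omega : 0 < N)
  have hΦ : K ^ s.index * catProd s ≤ (4 * K) ^ s.len := by
    calc K ^ s.index * catProd s ≤ K ^ s.len * 4 ^ s.len :=
          mul_le_mul (pow_le_pow_right₀ hK1 (Nat.sub_le _ _)) (catProd_le_four_pow s) (catProd_nonneg s)
            (by positivity)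
      _ = (4 * K) ^ s.len := by rw [mul_pow, mul_comm]
  calc |phi N β Λ s - ∑' X : Trajectory s, X.weight β| ≤ (3 * (3 / 4 : ℝ) ^ n + 20 / N) * (K ^ s.index * catProd s) :=
        H Λ hΛ N hN β hβ Good hGood n s hs hdeep
    _ ≤ (3 * (3 / 4 : ℝ) ^ n + 20 / N) * (4 * K) ^ s.len := mul_le_mul_of_nonneg_left hΦ (by positivity)
    _ = (4 * K) ^ s.len * (3 * (3 / 4 : ℝ) ^ n + 20 / N) := mul_comm _ _

variable {d}

/-- **Theorem 3.1 with the rate, along an exhaustion**: for `|β| ≤ β₀(d)`, every genuine `s` and every depth `n`,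
eventually in `N`: `|φ_{Λ_N,N,β}(s) − Σ_X w_β(X)| ≤ C^{|s|} (3 (3/4)ⁿ + 20/N)`.
[cite: Chatterjee2019LargeN, Theorem 3.1] -/
theorem eventually_abs_phi_sub_trajectorySum_le (hd : 2 ≤ d) :
    ∃ β₀ : ℝ, 0 < β₀ ∧ ∃ C : ℝ, 1 ≤ C ∧
      ∀ Λ : ℕ → Finset (Literature.Probability.LatticeModels.Site d), IsExhaustion Λ →
        ∀ β : ℝ, |β| ≤ β₀ → ∀ (n : ℕ) (s : LoopSeq d), IsLoopSeq s →
          ∀ᶠ N : ℕ in atTop, |phi N β (Λ N) s - ∑' X : Trajectory s, X.weight β| ≤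
            C ^ s.len * (3 * (3 / 4 : ℝ) ^ n + 20 / N) := by
  obtain ⟨β₀, hβ₀, C, hC1, H⟩ := abs_phi_sub_trajectorySum_le_pow d hd
  refine ⟨β₀, hβ₀, C, hC1, fun Λ hΛ β hβ n s hs => ?_⟩
  -- the depth grading «`t` and its splitting/deformation descendants of generation `< n` have their unit vertex
  -- neighbourhoods in `Λ'`», by recursion on `n`
  let Good : Finset (Literature.Probability.LatticeModels.Site d) → ℕ → LoopSeq d → Prop := fun Λ' =>
    Nat.rec (motive := fun _ => LoopSeq d → Prop) (fun _ => True) fun n G t =>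
      (∀ l ∈ t, ∀ a ∈ l, ∀ v : Literature.Probability.LatticeModels.Site d,
          latticeNorm (v - DEdge.src a) ≤ 1 ∨ latticeNorm (v - DEdge.tgt a) ≤ 1 → v ∈ Λ') ∧
        (∀ o : SameIdx t, G (t.posSplitAt o)) ∧ (∀ o : InvIdx t, G (t.negSplitAt o)) ∧
        (∀ o : DeformIdx t, G (t.posDeformAt o)) ∧ (∀ o : DeformIdx t, G (t.negDeformAt o))
  have hGood : ∀ (Λ' : Finset (Literature.Probability.LatticeModels.Site d)) (n : ℕ) (t : LoopSeq d),
      Good Λ' (n + 1) t →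
        (∀ l ∈ t, ∀ a ∈ l, ∀ v : Literature.Probability.LatticeModels.Site d,
            latticeNorm (v - DEdge.src a) ≤ 1 ∨ latticeNorm (v - DEdge.tgt a) ≤ 1 → v ∈ Λ') ∧
          (∀ o : SameIdx t, Good Λ' n (t.posSplitAt o)) ∧ (∀ o : InvIdx t, Good Λ' n (t.negSplitAt o)) ∧
          (∀ o : DeformIdx t, Good Λ' n (t.posDeformAt o)) ∧ (∀ o : DeformIdx t, Good Λ' n (t.negDeformAt o)) :=
    fun Λ' n t h => h
  -- along the exhaustion every depth is eventually reached
  have hev : ∀ (n : ℕ) (t : LoopSeq d), ∀ᶠ N : ℕ in atTop, Good (Λ N) n t := by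
    intro n
    induction n with
    | zero => intro t; exact Filter.Eventually.of_forall fun N => trivial
    | succ n ih =>
      intro t
      have h0 := hΛ.eventually_vertices_mem t
      have h1 : ∀ᶠ N : ℕ in atTop, ∀ o : SameIdx t, Good (Λ N) n (t.posSplitAt o) :=
        eventually_all.mpr fun o => ih _
      have h2 : ∀ᶠ N : ℕ in atTop, ∀ o : InvIdx t, Good (Λ N) n (t.negSplitAt o) :=
        eventually_all.mpr fun o => ih _
      have h3 : ∀ᶠ N : ℕ in atTop, ∀ o : DeformIdx t, Good (Λ N) n (t.posDeformAt o) :=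
        eventually_all.mpr fun o => ih _
      have h4 : ∀ᶠ N : ℕ in atTop, ∀ o : DeformIdx t, Good (Λ N) n (t.negDeformAt o) :=
        eventually_all.mpr fun o => ih _
      filter_upwards [h0, h1, h2, h3, h4] with N a b c e f
      exact ⟨a, b, c, e, f⟩
  obtain ⟨n₀, hn₀⟩ := hΛ.2 0
  have hne : ∀ᶠ N : ℕ in atTop, (Λ N).Nonempty := eventually_atTop.mpr ⟨n₀, fun N hN => ⟨0, hΛ.1 hN hn₀⟩⟩
  have h2 : ∀ᶠ N : ℕ in atTop, 2 ≤ N := eventually_ge_atTop 2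
  filter_upwards [hne, h2, hev n s] with N hN1 hN2 hN3
  exact H (Λ N) hN1 N hN2 β hβ (Good (Λ N)) (hGood (Λ N)) n s hs hN3

end StringDuality

end Summit.QuantumFields.GaugeBoot

end
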